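import Literature.NumberTheory.GaloisCohomology.Howard2004.TransportConnectingKernelProofs
import Literature.NumberTheory.GaloisCohomology.Howard2004.PropagateUnramifiedProofs
import Literature.NumberTheory.GaloisRepresentations.StrictSubgroupFunctorialityProofs
import HarnessLib

/-!
# Howard 2004, §1.3 / H.5(b): conjugation by `τ` carries a STRICT condition `ker (H¹(K_v̄, T) → H¹(K_v̄, T/V'))`
# onto the strict condition of `Tw T` at `v` cut out by `δ_v · V'`, and `θ_v` carries that onto the strict condition
# of `T` at `v` cut out by `θ(δ_v · V')` (theorems only)

Topic `NumberTheory/GaloisCohomology/Howard2004` (sequel to `TransportUnramified` — the same statement for the UNRAMIFIED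
condition, x9-p1-w4 — and to `StrictSubgroupFunctorialityProofs` — functoriality of the tree's strict condition
`DiscreteGaloisModule.strictSubgroup ρ V h = ker (H¹(F, W) → H¹(F, W/V))` in the module, x10b-p1-w6; theorems only — no
definition, no named fact, no instance, no `sorry`).

Howard 2004, §1.3 [arXiv:1202.6340 p. 7 L44–48, L96–97]: «conjugation by `τ` induces an isomorphism
`H¹(K_v̄, T) ≅ H¹(K_v, Tw(T))`», and hypothesis **H.5(b)** asks that, on the residual representation `T̄` with its
`G_ℚ`-structure `θ` (H.5(a)), `θ_v ∘ transport_v` carry the propagated local condition at `v̄ = v^τ` onto the one at `v`.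
At a place `v ∣ p` of good ORDINARY reduction the relevant residual condition is (cell `pub/bsd-print-x9`, D1 road, memo
`HOME/x9-p1-w3/H5B-AT-S-PLAN-w3g5.md` §3, non-anomalous case) the STRICT condition of the ordinary line
`Fil_v T̄ ⊂ T̄`: `ker (H¹(K_v, T̄) → H¹(K_v, T̄/Fil_v T̄)) = im H¹(K_v, Fil_v T̄)`; and `τ` carries `Fil_{v̄}` to `Fil_v`
(Howard §3.1; tree: x10b-p1-w5's `torsionMap_delta_apply_mem_torsionFilAt`).  This file proves the resulting transport
statement ONCE for arbitrary stable submodules: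

* §1 `DiscreteGaloisModule.oneCocycleClass_mem_strictSubgroup_iff_exists` — cocycle criterion: `[φ]` lies in the strict
  condition of `V` iff `φ` is principal modulo `V` (`φ g ≡ g w − w (mod V)` for one `w`).
* §2 **`ConjugationDatum.map_transportH1_strictSubgroup_eq`** — for ANY conjugation datum, `transport_v` carries the strict
  condition of `V' ≤ T` at `v̄` (stable under `Γ_{K_v̄}`) onto the strict condition of `Tw T` at `v` cut out by `δ_v · V'`
  (cocycle level, as in `map_transportH1_unramifiedSubgroup_eq`: `[c] ↦ [h ↦ δ_v c(φ_v h)]`, the inverse of the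
  continuous bijection `φ_v`, and the compatibility `τ⁻¹ res_v(g) τ = δ_v res_v̄(φ_v g) δ_v⁻¹` of the datum).
* §3 **`map_thetaH1_comp_transportH1_strictSubgroup_eq`** — with a `G_ℚ`-structure `θ` on `T` (`ResidualTau`) such that
  `x ↦ θ(δ_v x)` maps `V'` ONTO `V`: `(θ_v ∘ transport_v)(strict_{v̄}(V')) = strict_v(V)` — the shape of the `v`-clause of
  `Howard2004.H5b` for strict residual conditions (`θ_v` is `H¹` of a bijective equivariant map:
  `map_strictSubgroup_eq_of_bijective`).

HONEST FRAMING: local Galois-cohomology bookkeeping; nothing here is specific to elliptic curves; BSD is not proved by any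
of this.  Seat `bsd-line-x10b-p1-w8` g2.

References: [Howard2004HeegnerKolyvagin] B. Howard, *The Heegner point Kolyvagin system*, Compositio Math. 140 (2004),
§1.3 H.5 and §3.1 (arXiv:1202.6340 p. 7 L44–48 and L93–97, p. 15 L56–66); [SerreGaloisCohomology1997] I §2.2, §2.4
(compatible pairs), §5.1; [WashingtonCSS1997] §7 (strict condition).
-/

set_option autoImplicit false

noncomputable section

open Function NumberField IsDedekindDomain Field
open scoped NumberField ContRepresentation

/-! ## §1 Cocycle criterion for the strict condition -/

namespace Literature.NumberTheory.GaloisRepresentations.DiscreteGaloisModule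

variable {F : Type} [Field F] {W : Type} [AddCommGroup W] [TopologicalSpace W] [DiscreteTopology W]
  (ρ : DiscreteGaloisModule F W)

/-- **`[φ] ∈ ker (H¹(F, W) → H¹(F, W/V)) ⟺ φ` is principal modulo `V`**: for a `Γ_F`-stable submodule `V ≤ W` and a
continuous crossed homomorphism `φ`, the class `[φ]` lies in the strict condition `strictSubgroup ρ V h` iff there is
`w ∈ W` with `φ g − (g w − w) ∈ V` for all `g` (the class of `φ mod V` vanishes iff it is principal in `W/V`).
[cite: SerreGaloisCohomology1997, Ch. I §2.2 and §5.1 (trivial classes are principal)] [cite: WashingtonCSS1997, §7 (strict condition)] -/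
theorem oneCocycleClass_mem_strictSubgroup_iff_exists (V : Submodule ℤ W)
    (h : ∀ σ : absoluteGaloisGroup F, V ≤ V.comap (ρ σ)) (φ : contOneCocycles ρ.toTopRep) :
    (oneCocycleClass ρ.toTopRep φ : galoisCohomology ρ 1) ∈ ρ.strictSubgroup V h ↔
      ∃ w : W, ∀ g, φ.1 g - (ρ g w - w) ∈ V := by
  refine (mem_strictSubgroup_iff ρ V h _).trans ?_
  have hmap : ρ.quotientMap V h 1 (oneCocycleClass ρ.toTopRep φ) =
      oneCocycleClass (ρ.quotient V h).toTopRep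
        (contOneCocycles.pullback (ContinuousMonoidHom.id (absoluteGaloisGroup F))
          (X := ρ.toTopRep) (Y := (ρ.quotient V h).toTopRep)
          (TopRep.ofHom ⟨⟨V.mkQ.toAddMonoidHom.toIntLinearMap, continuous_of_discreteTopology⟩,
            fun g ↦ ContinuousLinearMap.ext fun x ↦ rfl⟩) φ) :=
    map_oneCocycleClass _ _ _ φ
  rw [hmap]
  refine (oneCocycleClass_eq_zero_iff _ _).trans ?_
  constructor
  · rintro ⟨q, hq⟩
    obtain ⟨w, rfl⟩ := Submodule.Quotient.mk_surjective V q
    refine ⟨w, fun g ↦ ?_⟩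
    have hg := hq g
    rw [contOneCocycles.pullback_apply] at hg
    change Submodule.Quotient.mk (φ.1 g) =
      Submodule.Quotient.mk (p := V) (ρ g w) - Submodule.Quotient.mk (p := V) w at hg
    rw [← Submodule.Quotient.mk_sub, Submodule.Quotient.eq] at hg
    exact hg
  · rintro ⟨w, hw⟩
    refine ⟨Submodule.Quotient.mk w, fun g ↦ ?_⟩
    rw [contOneCocycles.pullback_apply]
    change Submodule.Quotient.mk (φ.1 g) =
      Submodule.Quotient.mk (p := V) (ρ g w) - Submodule.Quotient.mk (p := V) w
    rw [← Submodule.Quotient.mk_sub, Submodule.Quotient.eq]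
    exact hw g

end Literature.NumberTheory.GaloisRepresentations.DiscreteGaloisModule

namespace Literature.NumberTheory.GaloisCohomology.Howard2004

open Literature.NumberTheory.GaloisRepresentations Literature.NumberTheory.GaloisRepresentations.DiscreteGaloisModule

/-! ## §2 Transport of a strict condition along a conjugation datum -/

namespace ConjugationDatum

variable {K : Type} [Field K] [NumberField K] {M : Type} [AddCommGroup M] [TopologicalSpace M]
  [DiscreteTopology M]

/-- The translate `δ_v · V'` of a `Γ_{K_v̄}`-stable submodule `V' ≤ T` is stable under the TWISTED local action at
`v` (`τ⁻¹ res_v(g) τ = δ_v res_v̄(φ_v g) δ_v⁻¹`). [cite: Howard2004HeegnerKolyvagin, §1.3 (arXiv p. 7, L44–48)] -/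
theorem map_delta_le_comap_twist (cd : ConjugationDatum K) (ρ : DiscreteGaloisModule K M)
    (v : HeightOneSpectrum (𝓞 K)) (V' : Submodule ℤ M)
    (hV' : ∀ g : absoluteGaloisGroup ((cd.σ • v).adicCompletion K),
      V' ≤ V'.comap (GaloisRep.toLocal (cd.σ • v) ρ g))
    (g : absoluteGaloisGroup (v.adicCompletion K)) :
    V'.map (ρ (cd.δ v)) ≤ (V'.map (ρ (cd.δ v))).comap (GaloisRep.toLocal v (cd.twist ρ) g) := by
  rintro _ ⟨x, hx, rfl⟩
  rw [Submodule.mem_comap]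
  refine ⟨ρ (absGaloisRestrict K ((cd.σ • v).adicCompletion K) (cd.φ v g)) x, hV' _ hx, ?_⟩
  change ρ.toRepresentation (cd.δ v) (ρ.toRepresentation (absGaloisRestrict K ((cd.σ • v).adicCompletion K) (cd.φ v g)) x) =
    ρ.toRepresentation (cd.conj (absGaloisRestrict K (v.adicCompletion K) g)) (ρ.toRepresentation (cd.δ v) x)
  rw [cd.conj_absGaloisRestrict_eq v g, map_mul, map_mul, Module.End.mul_apply, Module.End.mul_apply,
    ← Module.End.mul_apply (f := ρ.toRepresentation (cd.δ v)⁻¹), ← map_mul, inv_mul_cancel, map_one,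
    Module.End.one_apply]

/-- **`transportH1 (strict_{v̄}(V')) ≤ strict_v(δ_v · V')`** (twisted action at `v`): a cocycle `c` on `Γ_{K_v̄}` principal
modulo `V'`, `c(g) ≡ g m − m (mod V')`, transports to `h ↦ δ_v c(φ_v h) ≡ h·(δ_v m) − δ_v m (mod δ_v V')`.
[cite: Howard2004HeegnerKolyvagin, §1.3 (arXiv p. 7, L44–48) with §3.1 (arXiv p. 15, L56–66)] [cite: SerreGaloisCohomology1997, I §2.4] -/
theorem map_transportH1_strictSubgroup_le (cd : ConjugationDatum K) (ρ : DiscreteGaloisModule K M)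
    (v : HeightOneSpectrum (𝓞 K)) (V' : Submodule ℤ M)
    (hV' : ∀ g : absoluteGaloisGroup ((cd.σ • v).adicCompletion K),
      V' ≤ V'.comap (GaloisRep.toLocal (cd.σ • v) ρ g))
    (hδ : ∀ g : absoluteGaloisGroup (v.adicCompletion K),
      V'.map (ρ (cd.δ v)) ≤ (V'.map (ρ (cd.δ v))).comap (GaloisRep.toLocal v (cd.twist ρ) g)) :
    (strictSubgroup (GaloisRep.toLocal (cd.σ • v) ρ) V' hV').map (cd.transportH1 ρ v) ≤
      strictSubgroup (GaloisRep.toLocal v (cd.twist ρ)) (V'.map (ρ (cd.δ v))) hδ := by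
  rintro _ ⟨x, hx, rfl⟩
  obtain ⟨c, rfl⟩ := oneCocycleClass_surjective _ x
  obtain ⟨m, hm⟩ := (oneCocycleClass_mem_strictSubgroup_iff_exists (GaloisRep.toLocal (cd.σ • v) ρ) V' hV' c).mp hx
  change cd.transportH1 ρ v (oneCocycleClass _ c) ∈ strictSubgroup (GaloisRep.toLocal v (cd.twist ρ)) _ hδ
  rw [transportH1_oneCocycleClass]
  refine (oneCocycleClass_mem_strictSubgroup_iff_exists (GaloisRep.toLocal v (cd.twist ρ)) _ hδ _).mpr
    ⟨ρ (cd.δ v) m, fun g ↦ ?_⟩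
  rw [contOneCocycles.pullback_apply, transportHom_hom_apply]
  -- `τ⁻¹ res_v(g) τ` acts on `δ m` as `δ res_v̄(φ g)` acts on `m`
  have aux : ρ.toRepresentation (cd.conj (absGaloisRestrict K (v.adicCompletion K) g)) (ρ.toRepresentation (cd.δ v) m) =
      ρ.toRepresentation (cd.δ v)
        (ρ.toRepresentation (absGaloisRestrict K ((cd.σ • v).adicCompletion K) (cd.φ v g)) m) := by
    rw [cd.conj_absGaloisRestrict_eq v g, map_mul, map_mul, Module.End.mul_apply, Module.End.mul_apply,
      ← Module.End.mul_apply (f := ρ.toRepresentation (cd.δ v)⁻¹), ← map_mul, inv_mul_cancel, map_one,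
      Module.End.one_apply]
  change ρ.toRepresentation (cd.δ v) (c.1 (cd.φ v g)) -
      (ρ.toRepresentation (cd.conj (absGaloisRestrict K (v.adicCompletion K) g)) (ρ.toRepresentation (cd.δ v) m) -
        ρ.toRepresentation (cd.δ v) m) ∈ V'.map (ρ (cd.δ v))
  rw [aux, ← map_sub, ← map_sub]
  exact Submodule.mem_map_of_mem (hm (cd.φ v g))

/-- **`transportH1 (strict_{v̄}(V')) = strict_v(δ_v · V')`**: «conjugation by `τ` induces an isomorphism
`H¹(K_v̄, T) ≅ H¹(K_v, Tw T)`» carrying the strict condition of a `Γ_{K_v̄}`-stable `V' ≤ T` onto the strict condition of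
`Tw T` at `v` cut out by `δ_v V'`.  For `⊇`, a cocycle `d` of `Tw T` on `Γ_{K_v}` is the transport of
`g ↦ δ_v⁻¹ d(φ_v⁻¹ g)` (`φ_v` a continuous bijection of compact groups, hence a homeomorphism), which is principal modulo
`V'` when `d` is principal modulo `δ_v V'`.
[cite: Howard2004HeegnerKolyvagin, §1.3 (arXiv p. 7, L44–48) with §3.1 (arXiv p. 15, L56–66)] [cite: SerreGaloisCohomology1997, I §2.4] -/
theorem map_transportH1_strictSubgroup_eq (cd : ConjugationDatum K) (ρ : DiscreteGaloisModule K M)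
    (v : HeightOneSpectrum (𝓞 K)) (V' : Submodule ℤ M)
    (hV' : ∀ g : absoluteGaloisGroup ((cd.σ • v).adicCompletion K),
      V' ≤ V'.comap (GaloisRep.toLocal (cd.σ • v) ρ g))
    (hδ : ∀ g : absoluteGaloisGroup (v.adicCompletion K),
      V'.map (ρ (cd.δ v)) ≤ (V'.map (ρ (cd.δ v))).comap (GaloisRep.toLocal v (cd.twist ρ) g)) :
    (strictSubgroup (GaloisRep.toLocal (cd.σ • v) ρ) V' hV').map (cd.transportH1 ρ v) =
      strictSubgroup (GaloisRep.toLocal v (cd.twist ρ)) (V'.map (ρ (cd.δ v))) hδ := by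
  refine le_antisymm (cd.map_transportH1_strictSubgroup_le ρ v V' hV' hδ) fun y hy ↦ ?_
  -- read `y` in the `K_v = v.adicCompletion K` form of the local module (definitionally the same type)
  change galoisCohomology (GaloisRep.toLocal v (cd.twist ρ)) 1 at y
  obtain ⟨d, rfl⟩ := oneCocycleClass_surjective (GaloisRep.toLocal v (cd.twist ρ)).toTopRep y
  obtain ⟨w, hw⟩ := (oneCocycleClass_mem_strictSubgroup_iff_exists (GaloisRep.toLocal v (cd.twist ρ)) _ hδ d).mp hy
  -- `ψ = φ_v⁻¹`, continuous and multiplicative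
  obtain ⟨ψ, hφψ, hψφ, hmul⟩ := cd.exists_continuous_inverse_phi v
  have hcomm : ∀ (g : absoluteGaloisGroup ((cd.σ • v).adicCompletion K)) (y : M),
      ρ.toRepresentation (cd.δ v)⁻¹ (ρ.toRepresentation (cd.conj (absGaloisRestrict K (v.adicCompletion K) (ψ g))) y) =
        ρ.toRepresentation (absGaloisRestrict K ((cd.σ • v).adicCompletion K) g) (ρ.toRepresentation (cd.δ v)⁻¹ y) :=
    fun g y ↦ by
      rw [← Module.End.mul_apply, ← map_mul, cd.delta_inv_mul_conj_eq v hφψ g, map_mul, Module.End.mul_apply]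
  -- `δ⁻¹` maps `δ V'` back into `V'`
  have hinv : ∀ z ∈ V'.map (ρ (cd.δ v)), ρ (cd.δ v)⁻¹ z ∈ V' := by
    rintro _ ⟨x, hx, rfl⟩
    change ρ.toRepresentation (cd.δ v)⁻¹ (ρ.toRepresentation (cd.δ v) x) ∈ V'
    rwa [← Module.End.mul_apply, ← map_mul, inv_mul_cancel, map_one, Module.End.one_apply]
  -- the cocycle `c(g) = δ_v⁻¹ · d(ψ g)` of `T` on `Γ_{K_v̄}`: principal modulo `V'`, and transporting to `d`
  obtain ⟨c, hc_str, hc_eq⟩ : ∃ c : contOneCocycles (GaloisRep.toLocal (cd.σ • v) ρ).toTopRep,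
      oneCocycleClass _ c ∈ strictSubgroup (GaloisRep.toLocal (cd.σ • v) ρ) V' hV' ∧
        contOneCocycles.pullback (cd.φ v) (cd.transportHom ρ v) c = d := by
    refine ⟨⟨⟨fun g ↦ ρ (cd.δ v)⁻¹ (d.1 (ψ g)),
        continuous_of_discreteTopology.comp (d.1.continuous.comp ψ.continuous)⟩, fun g g' ↦ ?_⟩, ?_, ?_⟩
    · -- cocycle identity
      change ρ.toRepresentation (cd.δ v)⁻¹ (d.1 (ψ (g * g'))) =
        ρ.toRepresentation (cd.δ v)⁻¹ (d.1 (ψ g)) +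
          ρ.toRepresentation (absGaloisRestrict K ((cd.σ • v).adicCompletion K) g)
            (ρ.toRepresentation (cd.δ v)⁻¹ (d.1 (ψ g')))
      rw [hmul, d.2 (ψ g) (ψ g')]
      change ρ.toRepresentation (cd.δ v)⁻¹ (d.1 (ψ g) +
          ρ.toRepresentation (cd.conj (absGaloisRestrict K (v.adicCompletion K) (ψ g))) (d.1 (ψ g'))) = _
      rw [map_add, hcomm]
    · -- principal modulo `V'` at `v̄`
      refine (oneCocycleClass_mem_strictSubgroup_iff_exists (GaloisRep.toLocal (cd.σ • v) ρ) V' hV' _).mpr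
        ⟨ρ (cd.δ v)⁻¹ w, fun g ↦ ?_⟩
      have hg := hw (ψ g)
      change ρ.toRepresentation (cd.δ v)⁻¹ (d.1 (ψ g)) -
          (ρ.toRepresentation (absGaloisRestrict K ((cd.σ • v).adicCompletion K) g) (ρ.toRepresentation (cd.δ v)⁻¹ w) -
            ρ.toRepresentation (cd.δ v)⁻¹ w) ∈ V'
      rw [← hcomm, ← map_sub, ← map_sub]
      exact hinv _ hg
    · -- transports to `d`
      refine Subtype.ext (ContinuousMap.ext fun h ↦ ?_)
      change ρ.toRepresentation (cd.δ v) (ρ.toRepresentation (cd.δ v)⁻¹ (d.1 (ψ (cd.φ v h)))) = d.1 h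
      rw [hψφ, ← Module.End.mul_apply, ← map_mul, mul_inv_cancel, map_one, Module.End.one_apply]
  refine ⟨oneCocycleClass _ c, hc_str, ?_⟩
  rw [transportH1_oneCocycleClass, hc_eq]
  rfl

end ConjugationDatum

/-! ## §3 With the `G_ℚ`-structure `θ`: the `v`-clause of H.5(b) for strict conditions -/

section Theta

variable {K : Type} [Field K] [NumberField K] {M : Type} [AddCommGroup M] [TopologicalSpace M]
  [DiscreteTopology M] {R : Type} [CommRing R] [Module R M]

/-- **`(θ_v ∘ transport_v)(strict_{v̄}(V')) = strict_v(V)`** when `x ↦ θ(δ_v x)` maps the `Γ_{K_v̄}`-stable `V' ≤ T` ONTO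
the `Γ_{K_v}`-stable `V ≤ T` — the `v`-clause of Howard's H.5(b) for STRICT residual conditions (at `v ∣ p`:
`V' = Fil_{v̄} T̄`, `V = Fil_v T̄`, «`τ` carries `Fil_{v̄}` to `Fil_v`»).  Composition of §2 with `θ_v = H¹(θ)` for the
bijective equivariant `θ : Tw T → T` (`map_strictSubgroup_eq_of_bijective`).
[cite: Howard2004HeegnerKolyvagin, §1.3 H.5(b) and §3.1 (arXiv:1202.6340 p. 7 L93–97, p. 15 L56–66)]
[cite: SerreGaloisCohomology1997, I §2.2 and §2.4] -/
theorem map_thetaH1_comp_transportH1_strictSubgroup_eq (cd : ConjugationDatum K) (ρ : DiscreteGaloisModule K M)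
    (A : ResidualTau (R := R) cd ρ) (v : HeightOneSpectrum (𝓞 K)) (V' V : Submodule ℤ M)
    (hV' : ∀ g : absoluteGaloisGroup ((cd.σ • v).adicCompletion K),
      V' ≤ V'.comap (GaloisRep.toLocal (cd.σ • v) ρ g))
    (hV : ∀ g : absoluteGaloisGroup (v.adicCompletion K), V ≤ V.comap (GaloisRep.toLocal v ρ g))
    (hθ : ∀ x ∈ V', A.θ (ρ (cd.δ v) x) ∈ V) (hθ' : ∀ y ∈ V, ∃ x ∈ V', A.θ (ρ (cd.δ v) x) = y) :
    (strictSubgroup (GaloisRep.toLocal (cd.σ • v) ρ) V' hV').map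
        ((A.thetaH1 (Sum.inr v)).comp (cd.transportH1 ρ v)) =
      strictSubgroup (GaloisRep.toLocal v ρ) V hV := by
  -- `θ` as a continuous intertwining map of the local modules at `v`
  let fθ : (GaloisRep.toLocal v (cd.twist ρ)).toContRepresentation →ⁱL (GaloisRep.toLocal v ρ).toContRepresentation :=
    { toContinuousLinearMap := ⟨A.θ.toAddMonoidHom.toIntLinearMap, continuous_of_discreteTopology⟩
      isIntertwining' := fun g ↦ ContinuousLinearMap.ext fun x ↦ A.compat _ x }
  have hθmap : A.thetaH1 (Sum.inr v) = galoisCohomology.map fθ 1 :=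
    cohomologyMap_one_eq_map ((cd.twist ρ).toLocal (Sum.inr v)) (ρ.toLocal (Sum.inr v)) A.θ.toAddMonoidHom
      continuous_of_discreteTopology (fun _ x ↦ A.compat _ x) fθ fun _ ↦ rfl
  rw [← AddSubgroup.map_map, cd.map_transportH1_strictSubgroup_eq ρ v V' hV'
    (cd.map_delta_le_comap_twist ρ v V' hV'), hθmap]
  refine map_strictSubgroup_eq_of_bijective fθ (Function.Involutive.bijective A.involutive) _ _ V hV
    (fun w hw ↦ ?_) (fun y hy ↦ ?_)
  · obtain ⟨x, hx, rfl⟩ := hw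
    exact hθ x hx
  · obtain ⟨x, hx, hxy⟩ := hθ' y hy
    exact ⟨ρ (cd.δ v) x, Submodule.mem_map_of_mem hx, hxy⟩

end Theta

end Literature.NumberTheory.GaloisCohomology.Howard2004

end
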